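import Summits.HodgeConjecture.CorCM.MumfordTateRankCMThreefoldTimesCMCurves
import Summits.HodgeConjecture.CorCM.MumfordTateRankTypeIVThreefoldTimesCurves
import HarnessLib

/-!
# A field of degree `≢ 0 (mod 4)` has at most ONE quadratic subfield; hence two CM elliptic curves whose fields both map to `End⁰T`, `T` a simple
# CM abelian variety of ODD dimension, are isogenous — and the table `t(T × E₁ × E₂) ∈ {4, 5, 6}` (simple CM threefold × two CM curves) is EXACT

COR-CM (cell `pub-hodgecm2`, seat `b27` gen 51, count-neutral Mumford–Tate-rank ladder; theorems only, no definition, no named fact;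
UNCONDITIONAL — nothing here uses or asserts HC_CM).  Notation `t(X) = dim MT(H¹X)`.

Gen 50 (`CorCM/MumfordTateRankCMThreefoldTimesCMCurves`) proved, for `X ∼ T × (E₁ × E₂)` with `T` a simple CM threefold and `E₁`, `E₂` CM elliptic
curves: `t = 6 ↔ (E₁ ≁ E₂` and neither `End⁰E_a` maps to `K = End⁰T)`, `t ∈ {4, 5, 6}`, and left the cell «`E₁ ≁ E₂`, both fields map to `K`» covered
only by bounds.  That cell is EMPTY: `K` is a (CM) field of degree `2 · 3 = 6`, and a field extension `L/F` of degree not divisible by `4` contains at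
most one intermediate field of degree `2` (two distinct ones generate a compositum of degree `4`, Mathlib `IntermediateField.finrank_sup_le`, and
degrees of intermediate fields divide `[L : F]`); so two imaginary quadratic fields mapping to `K` are isomorphic, and CM elliptic curves with isomorphic
CM fields are isogenous (`isIsogenous_of_nonempty_ringHom_of_cmCurves`).  The same holds for every simple CM abelian variety of ODD dimension `g`
(`[End⁰T : ℚ] = 2g ≢ 0 mod 4`).

* §1 `intermediateField_eq_of_finrank_eq_two_of_not_four_dvd` — `¬ 4 ∣ [L : F]`, `[M₁ : F] = [M₂ : F] = 2` ⟹ `M₁ = M₂`;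
  `nonempty_ringHom_of_algHom_of_algHom_of_not_four_dvd` — two quadratic extensions mapping to such an `L` map to each other.
* §2 **`isIsogenous_of_cmCurves_of_nonempty_ringHom_of_isSimple_of_odd`** — CM curves `E₁`, `E₂` with ring homomorphisms `End⁰E_a → End⁰T`,
  `T` simple of CM type of odd dimension ⟹ `E₁ ∼ E₂`.
* §3 THE EXACT TABLE for a simple CM threefold `T` and ANY two CM elliptic curves (`X ∼ T × (E₁ × E₂)`):
  **`mtRank_hodge_one_eq_four_iff_…`** (`t = 4 ↔` both fields map to `K`), **`mtRank_hodge_one_eq_six_iff_…`** (`t = 6 ↔ E₁ ≁ E₂` and neither maps),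
  **`mtRank_hodge_one_eq_five_iff_…`** (`t = 5 ↔` otherwise: some field does not map to `K`, and (`E₁ ∼ E₂` or some field maps to `K`)).

## References
* [MoonenZarhin1999LowDim] B. Moonen, Yu. G. Zarhin, *Hodge classes on abelian varieties of low dimension*, Math. Ann. 315 (1999), Thm. (0.2) (a), (4),
  §3 (3.1), Lemma (3.3), Prop. (3.8) [corpus: paper:arxiv-math_9901113 pp. 1–2, 6–7]. [cite: MoonenZarhin1999LowDim, Thm. (0.2) and §3 Prop. (3.8)]
* [Shimura1998] G. Shimura, *Abelian Varieties with Complex Multiplication and Modular Functions*, §5.1 Prop. 6 (`End⁰` of a simple CM abelian variety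
  is a field of degree `2g`), §8.2 Prop. 26. [cite: Shimura1998, §5.1 Prop. 6]
* [Lang2002] S. Lang, *Algebra*, 3rd ed., V §1 Prop. 1.2 (tower law) and VI §1 Thm. 1.12–1.14 (compositum). [cite: Lang2002, V §1 Prop. 1.2]
* [SilvermanAdvancedTopics1994] J. H. Silverman, *Advanced Topics in the Arithmetic of Elliptic Curves*, II §2 (isogeny classes of CM curves ↔ CM fields).
  [cite: SilvermanAdvancedTopics1994, II §1 Prop. 1.2 and Prop. 1.4]
-/

noncomputable section

open CategoryTheory CategoryTheory.Limits Module IntermediateField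

namespace Summit.HodgeConjecture.CorCM

open Literature.AlgebraicGeometry.Motives
open Literature.AlgebraicGeometry.Motives.AbelianVariety
open Literature.AlgebraicGeometry.HodgeTheory
open Literature.AlgebraicGeometry.Milne1999 (IsOfCMType isOfCMType_iff_of_isIsogenous IsOfCMType.isOfCMTypeSimple)

/-! ## §1 A field of degree not divisible by `4` has at most one quadratic subfield -/

/-- **Two intermediate fields of degree `2` in an extension `L/F` with `4 ∤ [L : F]` coincide**: otherwise their compositum has degree `4`
(`≤ 2 · 2`, a proper multiple of `2`) dividing `[L : F]`. [cite: Lang2002, V §1 Prop. 1.2 and VI §1 Thm. 1.12] -/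
theorem intermediateField_eq_of_finrank_eq_two_of_not_four_dvd {F L : Type*} [Field F] [Field L] [Algebra F L] [FiniteDimensional F L]
    (h4 : ¬ 4 ∣ finrank F L) {M₁ M₂ : IntermediateField F L} (h₁ : finrank F M₁ = 2) (h₂ : finrank F M₂ = 2) : M₁ = M₂ := by
  have hle : finrank F ↥(M₁ ⊔ M₂) ≤ 4 := by simpa [h₁, h₂] using IntermediateField.finrank_sup_le M₁ M₂
  have hdvd₁ : 2 ∣ finrank F ↥(M₁ ⊔ M₂) := h₁ ▸ IntermediateField.finrank_dvd_of_le_right le_sup_left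
  have hdvdL : finrank F ↥(M₁ ⊔ M₂) ∣ finrank F L := by
    simpa only [IntermediateField.finrank_top'] using IntermediateField.finrank_dvd_of_le_right (le_top : M₁ ⊔ M₂ ≤ ⊤)
  have hpos : 0 < finrank F ↥(M₁ ⊔ M₂) := finrank_pos
  obtain ⟨c, hc⟩ := hdvd₁
  have hc2 : c ≠ 2 := by
    rintro rfl
    exact h4 (by simpa [hc] using hdvdL)
  have h12 : finrank F ↥(M₁ ⊔ M₂) = 2 := by omega
  exact (IntermediateField.eq_of_le_of_finrank_eq le_sup_left (h₁.trans h12.symm)).trans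
    (IntermediateField.eq_of_le_of_finrank_eq le_sup_right (h₂.trans h12.symm)).symm

/-- **Two quadratic extensions of `F` mapping to an extension `L/F` of degree `≢ 0 (mod 4)` map to each other**: their images are the same
quadratic intermediate field.  (Stated for rings that ARE fields, `IsField`, so that it applies verbatim to endomorphism algebras.)
[cite: Lang2002, V §1 Prop. 1.2 and VI §1 Thm. 1.12] -/
theorem nonempty_ringHom_of_algHom_of_algHom_of_not_four_dvd {F k₁ k₂ L : Type*} [Field F] [Ring k₁] [Ring k₂] [Ring L] [Algebra F k₁]
    [Algebra F k₂] [Algebra F L] [Module.Finite F L] (hk₁ : IsField k₁) (hk₂ : IsField k₂) (hL : IsField L) (h4 : ¬ 4 ∣ finrank F L)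
    (h₁ : finrank F k₁ = 2) (h₂ : finrank F k₂ = 2) (g₁ : k₁ →ₐ[F] L) (g₂ : k₂ →ₐ[F] L) : Nonempty (k₂ →+* k₁) := by
  letI := hL.toField
  letI := hk₁.toField
  letI := hk₂.toField
  have hM₁ : finrank F g₁.fieldRange = 2 := by rw [← g₁.equivFieldRange.toLinearEquiv.finrank_eq, h₁]
  have hM₂ : finrank F g₂.fieldRange = 2 := by rw [← g₂.equivFieldRange.toLinearEquiv.finrank_eq, h₂]
  have hM : g₂.fieldRange = g₁.fieldRange := intermediateField_eq_of_finrank_eq_two_of_not_four_dvd h4 hM₂ hM₁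
  exact ⟨(g₁.equivFieldRange.symm.toAlgHom.comp ((IntermediateField.equivOfEq hM).toAlgHom.comp g₂.equivFieldRange.toAlgHom)).toRingHom⟩

/-! ## §2 Two CM elliptic curves whose fields map to `End⁰T`, `T` simple of CM type of odd dimension, are isogenous -/

variable {X T E₁ E₂ : AbelianVariety ℂ} {n : ℕ}

/-- **CM curves `E₁`, `E₂` with ring homomorphisms `End⁰E₁ → End⁰T`, `End⁰E₂ → End⁰T` into a FIELD `End⁰T` of degree `≢ 0 (mod 4)` are isogenous**
(both images are the unique quadratic subfield, so `End⁰E₂ → End⁰E₁`; CM curves with a ring homomorphism between their fields are isogenous).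
[cite: SilvermanAdvancedTopics1994, II §1 Prop. 1.2 and Prop. 1.4] [cite: Lang2002, V §1 Prop. 1.2 and VI §1 Thm. 1.12] -/
theorem isIsogenous_of_cmCurves_of_nonempty_ringHom_of_isField (hE₁1 : E₁.dim = 1) (hE₁cm : IsOfCMType E₁) (hE₂1 : E₂.dim = 1)
    (hE₂cm : IsOfCMType E₂) (hF : IsField T.endAlgebra) (h4 : ¬ 4 ∣ finrank ℚ T.endAlgebra) (h₁ : Nonempty (E₁.endAlgebra →+* T.endAlgebra))
    (h₂ : Nonempty (E₂.endAlgebra →+* T.endAlgebra)) : IsIsogenous E₁ E₂ := by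
  classical
  obtain ⟨f₁⟩ := h₁
  obtain ⟨f₂⟩ := h₂
  haveI : Module.Finite ℚ T.endAlgebra := AbelianVariety.finiteDimensional_endAlgebra_holds T
  exact isIsogenous_of_nonempty_ringHom_of_cmCurves hE₁1 hE₁cm hE₂1 hE₂cm
    (nonempty_ringHom_of_algHom_of_algHom_of_not_four_dvd (PeriodCurve.isField_endAlgebra_of_dim_eq_one hE₁1)
      (PeriodCurve.isField_endAlgebra_of_dim_eq_one hE₂1) hF h4 (finrank_endAlgebra_eq_two_of_cmCurve hE₁1 hE₁cm)
      (finrank_endAlgebra_eq_two_of_cmCurve hE₂1 hE₂cm) f₁.toRatAlgHom f₂.toRatAlgHom)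

/-- **CM curves whose fields both map to `End⁰T`, `T` a SIMPLE abelian variety of CM type of ODD dimension, are isogenous**: `End⁰T` is a field of degree
`2 · dim T ≢ 0 (mod 4)` (Shimura §5.1 Prop. 6; the tree's `IsOfCMType.isOfCMTypeSimple`). [cite: Shimura1998, §5.1 Prop. 6]
[cite: SilvermanAdvancedTopics1994, II §1 Prop. 1.2 and Prop. 1.4] -/
theorem isIsogenous_of_cmCurves_of_nonempty_ringHom_of_isSimple_of_odd (hE₁1 : E₁.dim = 1) (hE₁cm : IsOfCMType E₁) (hE₂1 : E₂.dim = 1)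
    (hE₂cm : IsOfCMType E₂) (hTs : T.IsSimple) (hTcm : IsOfCMType T) (hodd : Odd T.dim) (h₁ : Nonempty (E₁.endAlgebra →+* T.endAlgebra))
    (h₂ : Nonempty (E₂.endAlgebra →+* T.endAlgebra)) : IsIsogenous E₁ E₂ := by
  obtain ⟨hF, hdeg⟩ := IsOfCMType.isOfCMTypeSimple hTs hodd.pos hTcm
  refine isIsogenous_of_cmCurves_of_nonempty_ringHom_of_isField hE₁1 hE₁cm hE₂1 hE₂cm hF (fun h4 => ?_) h₁ h₂
  rw [hdeg] at h4
  obtain ⟨k, hk⟩ := hodd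
  omega

variable [HodgeTensorFacts.{0, 0}]

/-! ## §3 The exact table for a simple CM threefold and two CM elliptic curves -/

/-- **`t(T × E₁ × E₂) = 4` iff BOTH curve fields map to `K = End⁰T`** (`T` a simple CM threefold, `E₁`, `E₂` any CM elliptic curves).  (`⇐`: the curves are
then isogenous, the second is a duplicate factor and `t(T × E₁) = 4`; `⇒`: `t ≥ t(T × E_a) ∈ {4, 5}` for `a = 1, 2` by the monotonicity of the CM family
rank, so both `t(T × E_a) = 4`.) [cite: MoonenZarhin1999LowDim, Thm. (0.2) and §3 Prop. (3.8)] [cite: Shimura1998, §5.1 Prop. 6] -/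
theorem mtRank_hodge_one_eq_four_iff_of_isIsogenous_cmThreefold_prod_cmCurves (hX : IsSmoothProjective n X.X) (hTs : T.IsSimple) (hT3 : T.dim = 3)
    (hTcm : IsOfCMType T) (hE₁1 : E₁.dim = 1) (hE₁cm : IsOfCMType E₁) (hE₂1 : E₂.dim = 1) (hE₂cm : IsOfCMType E₂)
    (hXP : IsIsogenous X (T.prod (E₁.prod E₂))) :
    haveI := BettiUniverse.finite hX 1
    (BettiUniverse.hodge exists_isReal_hodgeModel_holds hX 1).mtRank = 4 ↔
      Nonempty (E₁.endAlgebra →+* T.endAlgebra) ∧ Nonempty (E₂.endAlgebra →+* T.endAlgebra) := by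
  classical
  haveI := BettiUniverse.finite hX 1
  have hY₁ : IsSmoothProjective (T.prod E₁).dim (T.prod E₁).X := AbelianVariety.isSmoothProjective_holds
  have hY₂ : IsSmoothProjective (T.prod E₂).dim (T.prod E₂).X := AbelianVariety.isSmoothProjective_holds
  haveI := BettiUniverse.finite hY₁ 1
  haveI := BettiUniverse.finite hY₂ 1
  have h4iff₁ := mtRank_hodge_one_eq_four_iff_nonempty_ringHom_of_isIsogenous_cmCurve_prod_isSimple_cmThreefold hY₁ hE₁1 hE₁cm hTs hT3 hTcm
    (isIsogenous_prod_comm T E₁)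
  have h4iff₂ := mtRank_hodge_one_eq_four_iff_nonempty_ringHom_of_isIsogenous_cmCurve_prod_isSimple_cmThreefold hY₂ hE₂1 hE₂cm hTs hT3 hTcm
    (isIsogenous_prod_comm T E₂)
  -- the duplicate-factor reading when `E₁ ∼ E₂`: `t(X) = t(T × E₁)`
  have hdup : IsIsogenous E₁ E₂ →
      (BettiUniverse.hodge exists_isReal_hodgeModel_holds hX 1).mtRank = (BettiUniverse.hodge exists_isReal_hodgeModel_holds hY₁ 1).mtRank :=
    fun h12 => mtRank_hodge_one_eq_of_isIsogenous_prod_prod_self hX hY₁ (by rw [dim_prod]; omega)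
      ((hXP.trans ((IsIsogenous.refl T).prod ((IsIsogenous.refl E₁).prod h12.symm'))).trans
        (Literature.AlgebraicGeometry.HodgeTheory.isIsogenous_prod_assoc T E₁ E₁).symm') (IsIsogenous.refl _)
  constructor
  · intro h4
    by_cases h12 : IsIsogenous E₁ E₂
    · have hf₁ : Nonempty (E₁.endAlgebra →+* T.endAlgebra) := h4iff₁.1 (by rw [← hdup h12]; exact h4)
      obtain ⟨f₁⟩ := hf₁
      obtain ⟨a⟩ := h12.symm'.nonempty_endAlgebra_algEquiv
      exact ⟨⟨f₁⟩, ⟨f₁.comp a.toRingEquiv.toRingHom⟩⟩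
    · obtain ⟨-, hmono₁, hmono₂, -⟩ := mtRank_hodge_one_cmThreefold_prod_cmCurves hX hTs hT3 hTcm hE₁1 hE₁cm hE₂1 hE₂cm h12 hY₁ hY₂
        (IsIsogenous.refl _) (IsIsogenous.refl _) hXP
      have h45₁ := mtRank_hodge_one_mem_of_isIsogenous_cmCurve_prod_isSimple_cmThreefold hY₁ hE₁1 hE₁cm hTs hT3 hTcm (isIsogenous_prod_comm T E₁)
      have h45₂ := mtRank_hodge_one_mem_of_isIsogenous_cmCurve_prod_isSimple_cmThreefold hY₂ hE₂1 hE₂cm hTs hT3 hTcm (isIsogenous_prod_comm T E₂)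
      exact ⟨h4iff₁.1 (by rcases h45₁ with h | h <;> omega), h4iff₂.1 (by rcases h45₂ with h | h <;> omega)⟩
  · rintro ⟨hf₁, hf₂⟩
    have h12 : IsIsogenous E₁ E₂ :=
      isIsogenous_of_cmCurves_of_nonempty_ringHom_of_isSimple_of_odd hE₁1 hE₁cm hE₂1 hE₂cm hTs hTcm (by rw [hT3]; exact ⟨1, rfl⟩) hf₁ hf₂
    rw [hdup h12]
    exact h4iff₁.2 hf₁

/-- **`t(T × E₁ × E₂) = 6` iff `E₁ ≁ E₂` and NEITHER curve field maps to `K = End⁰T`** (for isogenous curves `t = t(T × E₁) ∈ {4, 5}`).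
[cite: MoonenZarhin1999LowDim, Thm. (0.2) and §3 Prop. (3.8)] -/
theorem mtRank_hodge_one_eq_six_iff_of_isIsogenous_cmThreefold_prod_cmCurves (hX : IsSmoothProjective n X.X) (hTs : T.IsSimple) (hT3 : T.dim = 3)
    (hTcm : IsOfCMType T) (hE₁1 : E₁.dim = 1) (hE₁cm : IsOfCMType E₁) (hE₂1 : E₂.dim = 1) (hE₂cm : IsOfCMType E₂)
    (hXP : IsIsogenous X (T.prod (E₁.prod E₂))) :
    haveI := BettiUniverse.finite hX 1
    (BettiUniverse.hodge exists_isReal_hodgeModel_holds hX 1).mtRank = 6 ↔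
      ¬ IsIsogenous E₁ E₂ ∧ IsEmpty (E₁.endAlgebra →+* T.endAlgebra) ∧ IsEmpty (E₂.endAlgebra →+* T.endAlgebra) := by
  classical
  haveI := BettiUniverse.finite hX 1
  have hY₁ : IsSmoothProjective (T.prod E₁).dim (T.prod E₁).X := AbelianVariety.isSmoothProjective_holds
  have hY₂ : IsSmoothProjective (T.prod E₂).dim (T.prod E₂).X := AbelianVariety.isSmoothProjective_holds
  haveI := BettiUniverse.finite hY₁ 1
  haveI := BettiUniverse.finite hY₂ 1
  have hsix : ¬ IsIsogenous E₁ E₂ → ((BettiUniverse.hodge exists_isReal_hodgeModel_holds hX 1).mtRank = 6 ↔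
      IsEmpty (E₁.endAlgebra →+* T.endAlgebra) ∧ IsEmpty (E₂.endAlgebra →+* T.endAlgebra)) := fun h12 =>
    (mtRank_hodge_one_cmThreefold_prod_cmCurves hX hTs hT3 hTcm hE₁1 hE₁cm hE₂1 hE₂cm h12 hY₁ hY₂ (IsIsogenous.refl _) (IsIsogenous.refl _) hXP).1
  constructor
  · intro h6
    by_cases h12 : IsIsogenous E₁ E₂
    · exfalso
      have hdup := mtRank_hodge_one_eq_of_isIsogenous_prod_prod_self hX hY₁ (by rw [dim_prod]; omega)
        ((hXP.trans ((IsIsogenous.refl T).prod ((IsIsogenous.refl E₁).prod h12.symm'))).trans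
          (Literature.AlgebraicGeometry.HodgeTheory.isIsogenous_prod_assoc T E₁ E₁).symm') (IsIsogenous.refl _)
      rcases mtRank_hodge_one_mem_of_isIsogenous_cmCurve_prod_isSimple_cmThreefold hY₁ hE₁1 hE₁cm hTs hT3 hTcm (isIsogenous_prod_comm T E₁) with
        h | h <;> omega
    · exact ⟨h12, (hsix h12).1 h6⟩
  · rintro ⟨h12, h⟩
    exact (hsix h12).2 h

/-- **`t(T × E₁ × E₂) = 5` iff SOME curve field does not map to `K = End⁰T` and (`E₁ ∼ E₂` or some curve field maps to `K`)** — the complement of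
the cells `4` (both map) and `6` (`E₁ ≁ E₂`, neither maps) in the table `{4, 5, 6}`. [cite: MoonenZarhin1999LowDim, Thm. (0.2) and §3 Prop. (3.8)] -/
theorem mtRank_hodge_one_eq_five_iff_of_isIsogenous_cmThreefold_prod_cmCurves (hX : IsSmoothProjective n X.X) (hTs : T.IsSimple) (hT3 : T.dim = 3)
    (hTcm : IsOfCMType T) (hE₁1 : E₁.dim = 1) (hE₁cm : IsOfCMType E₁) (hE₂1 : E₂.dim = 1) (hE₂cm : IsOfCMType E₂)
    (hXP : IsIsogenous X (T.prod (E₁.prod E₂))) :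
    haveI := BettiUniverse.finite hX 1
    (BettiUniverse.hodge exists_isReal_hodgeModel_holds hX 1).mtRank = 5 ↔
      (IsEmpty (E₁.endAlgebra →+* T.endAlgebra) ∨ IsEmpty (E₂.endAlgebra →+* T.endAlgebra)) ∧
        (IsIsogenous E₁ E₂ ∨ Nonempty (E₁.endAlgebra →+* T.endAlgebra) ∨ Nonempty (E₂.endAlgebra →+* T.endAlgebra)) := by
  classical
  haveI := BettiUniverse.finite hX 1
  have h4 := mtRank_hodge_one_eq_four_iff_of_isIsogenous_cmThreefold_prod_cmCurves hX hTs hT3 hTcm hE₁1 hE₁cm hE₂1 hE₂cm hXP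
  have h6 := mtRank_hodge_one_eq_six_iff_of_isIsogenous_cmThreefold_prod_cmCurves hX hTs hT3 hTcm hE₁1 hE₁cm hE₂1 hE₂cm hXP
  have h456 := mtRank_hodge_one_mem_of_isIsogenous_cmThreefold_prod_cmCurves hX hTs hT3 hTcm hE₁1 hE₁cm hE₂1 hE₂cm hXP
  simp only [Finset.mem_insert, Finset.mem_singleton] at h456
  constructor
  · intro h5
    refine ⟨?_, ?_⟩
    · by_contra hne
      obtain ⟨hn₁, hn₂⟩ := not_or.1 hne
      have := h4.2 ⟨not_isEmpty_iff.1 hn₁, not_isEmpty_iff.1 hn₂⟩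
      omega
    · by_contra hne
      obtain ⟨h12, hne'⟩ := not_or.1 hne
      obtain ⟨hn₁, hn₂⟩ := not_or.1 hne'
      have := h6.2 ⟨h12, not_nonempty_iff.1 hn₁, not_nonempty_iff.1 hn₂⟩
      omega
  · rintro ⟨hsome, hor⟩
    rcases h456 with h | h | h
    · obtain ⟨hn₁, hn₂⟩ := h4.1 h
      exact (hsome.elim (fun e => not_nonempty_iff.2 e hn₁) (fun e => not_nonempty_iff.2 e hn₂)).elim
    · exact h
    · obtain ⟨h12, he₁, he₂⟩ := h6.1 h
      exact (hor.elim h12 (fun h' => h'.elim (fun hn₁ => not_nonempty_iff.2 he₁ hn₁) (fun hn₂ => not_nonempty_iff.2 he₂ hn₂))).elim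

end Summit.HodgeConjecture.CorCM

end
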